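import Literature.Computability.Cryptography.CsidhAction
import Literature.NumberTheory.QuadraticFields.ZsqrtdFormClassGroupProofs
import Literature.NumberTheory.LFunctions.DedekindZeta
import Mathlib.Analysis.SpecialFunctions.Pow.Real
import HarnessLib

/-!
# Small split primes generate `cl(ℤ[√-p])` under GRH (Jao–Miller–Venkatesan), and the CSIDH
# generator list

Topic `Computability/Cryptography`; companion of `CsidhAction.lean` (definition item
`defn-csidhAction`: the `gens` component of the white-box torsor interface of route
QuantumAdvantage/PadKuperberg). For a prime `p` and the order `𝒪 = ℤ[√-p]` (discriminant
`Δ = -4p`, conductor `2` when `p ≡ 3 (mod 4)`):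

* `primeIdeal p ℓ t = (ℓ, t + √-p)`: for an odd prime `ℓ ∣ t² + p` this is the prime ideal of
  norm `ℓ` above `ℓ` (`𝒪/(ℓ, t + √-p) ≅ 𝔽_ℓ`, `√-p ↦ -t`); CSIDH §3 writes it `(ℓ, π - λ)`;
* `classOf p I ∈ ClassGroup (ℤ√(-p))`, the class of an integral ideal (junk `1` if not
  invertible), with `toClass (-p) f = classOf p (ideal (-p) f)` (`toClass_eq_classOf`);
* `smallPrimeClasses p x` — the Jao–Miller–Venkatesan/Childs–Jao–Soukharev generating set
  `A_x = {[𝔭] : 𝔭 prime, coprime to the conductor, N(𝔭) ≤ x prime}` of `cl(𝒪)`, written out as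
  the classes of the `(ℓ, t + √-p)`, `ℓ` an odd prime `≤ x`, `ℓ ∣ t² + p`;
* the named fact `jmv_smallPrimesGenerate` (D-0014): under ERH, for every `B > 2` and all
  sufficiently large primes `p ≡ 3 (mod 4)`, `A_x` generates `cl(ℤ[√-p])` for
  `x = (log(4p))^B` — the generation corollary of Jao–Miller–Venkatesan 2009, Cor. 1.3 with
  Thm. 3.2 (= Childs–Jao–Soukharev 2014, Thm. 2.1), stated in its "for `q` sufficiently large"
  form (JMV Remark 2.2: for finitely many small `q` the Cayley graph may be disconnected);
* the concrete **generator list** `gens p : List BinQF` (labels of the `(ℓ, t₀ + √-p)`, `ℓ` odd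
  prime `≤ ⌊(log 4p)³⌋`, `t₀` the least square root of `-p (mod ℓ)`), `isLabel_of_mem_gens`, and
  `exists_closure_toClass_gens_eq_top`: under `jmv_smallPrimesGenerate` (and ERH; Cox Thm. 7.7 is
  the tree's theorem `cox_formClassGroup_holds`) the classes of `gens p` generate `cl(ℤ[√-p])`
  for all large `p ≡ 3 (mod 4)` — through `primeIdeal_mul_primeIdeal_neg`
  (`(ℓ, t + √-p)(ℓ, -t + √-p) = (ℓ)` for `ℓ ∤ 2t`), i.e. conjugate ideals have inverse classes.

Bach's explicit bound `6 log²|Δ|` (Bach 1990) concerns maximal orders and is not vendored.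
Mathlib (pin v4.32.0): `ClassGroup`, `FractionalIdeal`, `Ideal.span_pair_mul_span_pair`,
`Real.rpow`, `Nat.floor`; no ring class groups or GRH generator bounds.

## References

* [JaoMillerVenkatesan2009] D. Jao, S. D. Miller, R. Venkatesan, *Expander graphs based on GRH
  with an application to elliptic curve cryptography*, J. Number Theory 129 (2009), Thm. 1.1,
  Cor. 1.3, Remark 2.2, Thm. 3.2 (arXiv:0811.0647, held).
* [ChildsJaoSoukharev2014] A. Childs, D. Jao, V. Soukharev, *Constructing elliptic curve
  isogenies in quantum subexponential time*, J. Math. Cryptol. 8 (2014), Thm. 2.1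
  (arXiv:1012.4019, held).
* [CastryckEtAl2018] W. Castryck et al., *CSIDH*, ASIACRYPT 2018, §3 ("`𝔩 = (ℓ, π - λ)`").
* [Bordelles2020] (through `Literature.NumberTheory.LFunctions.ExtendedRiemannHypothesis`).
-/

noncomputable section

open scoped Classical nonZeroDivisors

namespace Literature.Computability.Cryptography.Csidh

open Literature.NumberTheory.QuadraticFields.Quadratic
open Literature.NumberTheory.QuadraticFields.Quadratic.BinQF

attribute [local instance] isDomain_zsqrtd_neg

variable (p : ℕ) [Fact p.Prime]

/-! ### Prime ideals `(ℓ, t + √-p)` and classes of ideals -/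

/-- The ideal `(ℓ, t + √-p)` of `ℤ[√-p]`; for an odd prime `ℓ` with `ℓ ∣ t² + p` it is the prime
ideal of norm `ℓ` with `√-p ≡ -t`, CSIDH's `𝔩 = (ℓ, π - λ)` with `λ = -t`.
[cite: CastryckEtAl2018, §3 (class-group action: "`𝔩 = (ℓ, π - λ)`")] -/
def primeIdeal (ℓ : ℕ) (t : ℤ) : Ideal (ℤ√(-(p : ℤ))) :=
  Ideal.span {(ℓ : ℤ√(-(p : ℤ))), ⟨t, 1⟩}

/-- The class in `cl(ℤ[√-p]) = ClassGroup (ℤ√(-p))` of an integral ideal, junk value `1` when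
the ideal is not invertible (Cox §7.A: `C(𝒪) = I(𝒪)/P(𝒪)`). [folklore] -/
def classOf (I : Ideal (ℤ√(-(p : ℤ)))) : ClassGroup (ℤ√(-(p : ℤ))) :=
  if h : IsUnit (I : FractionalIdeal (ℤ√(-(p : ℤ)))⁰ (FractionRing (ℤ√(-(p : ℤ))))) then
    ClassGroup.mk (FractionRing (ℤ√(-(p : ℤ)))) h.unit
  else 1

/-- The class of a form is the class of its ideal. [folklore] -/
theorem toClass_eq_classOf (f : BinQF) : toClass (-(p : ℤ)) f = classOf p (ideal (-(p : ℤ)) f) :=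
  rfl

variable {p} in
/-- On invertible ideals `classOf` is the class of the ideal. [folklore] -/
theorem classOf_of_isUnit {I : Ideal (ℤ√(-(p : ℤ)))}
    (h : IsUnit (I : FractionalIdeal (ℤ√(-(p : ℤ)))⁰ (FractionRing (ℤ√(-(p : ℤ)))))) :
    classOf p I = ClassGroup.mk (FractionRing (ℤ√(-(p : ℤ)))) h.unit :=
  dif_pos h

/-- **The JMV/CJS generating set** `A_x ⊆ cl(ℤ[√-p])`: the classes of the prime ideals of
`ℤ[√-p]` coprime to the conductor `2` whose norm is a prime `ℓ ≤ x`, i.e. of the ideals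
`(ℓ, t + √-p)` with `ℓ` an odd prime, `ℓ ≤ x`, `ℓ ∣ t² + p` (Jao–Miller–Venkatesan Thm. 1.1:
"prime ideals `𝔭` coprime to `𝔪` | `N𝔭 ≤ x` is prime"; Childs–Jao–Soukharev Thm. 2.1:
`A = {[𝔭] : gcd(c, 𝔭) = 1 and N(𝔭) ≤ x is prime}`).
[cite: JaoMillerVenkatesan2009, Thm. 1.1 and Thm. 3.2] -/
def smallPrimeClasses (x : ℝ) : Set (ClassGroup (ℤ√(-(p : ℤ)))) :=
  {C | ∃ (ℓ : ℕ) (t : ℤ), ℓ.Prime ∧ ℓ ≠ 2 ∧ (ℓ : ℝ) ≤ x ∧ (ℓ : ℤ) ∣ t ^ 2 + p ∧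
    C = classOf p (primeIdeal p ℓ t)}

/-! ### Named fact: Jao–Miller–Venkatesan, Cor. 1.3 / Childs–Jao–Soukharev, Thm. 2.1 -/

/-- **Small split primes generate the class group of `ℤ[√-p]` under GRH** (the generation
corollary of Jao–Miller–Venkatesan 2009, Cor. 1.3 with Thm. 1.1 and Thm. 3.2; restated for
imaginary quadratic orders as Childs–Jao–Soukharev 2014, Thm. 2.1). JMV Thm. 1.1 ("GRH graphs"):
for a number field `K`, an integral ideal `𝔪`, `G` the narrow ray class group mod `𝔪`,
`q = D · N𝔪`, and `S_x` the images and inverses in `G` of the prime ideals coprime to `𝔪` of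
prime norm `≤ x`, assuming GRH for the characters of `G`, `Cay(G, S_x)` is an expander as soon
as `B > 2` and `x ≥ (log q)^B`; Remark 1.2(a): the same holds for quotients of `G`; Cor. 1.3:
"for `q` sufficiently large, a random walk of length `t ≥ C log|G|/log log q` from any starting
vertex lands in any fixed subset `S ⊂ G` with probability at least `|S|/(2|G|)`"; Thm. 3.2 and
its proof: `Cl(𝒪_D)` is a quotient of the narrow ray class group of `ℚ(√D)` mod the conductor,
`q = |D|`. Taking `S = {g}` the landing probability is positive, so `S_x` generates `G`: here
`G = cl(ℤ[√-p])`, `D = Δ = -4p` (prime `p ≡ 3 (mod 4)`, conductor `2`), `x = (log 4p)^B`, and the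
hypothesis is the tree's `ExtendedRiemannHypothesis` (ERH for all number fields, which implies
GRH for the Hecke `L`-functions of the finite-order characters of `G`). Stated, as printed, for
`q` sufficiently large (JMV Remark 2.2: "for a finite number of cases when `q` is small, the
graph `Γ_x` may actually be disconnected").
[cite: JaoMillerVenkatesan2009, Cor. 1.3 with Thm. 1.1, Rem. 1.2(a), Thm. 3.2] -/
def jmv_smallPrimesGenerate : Prop :=
  Literature.NumberTheory.LFunctions.ExtendedRiemannHypothesis →
    ∀ B : ℝ, 2 < B → ∃ P₀ : ℕ, ∀ (p : ℕ) [Fact p.Prime], P₀ ≤ p → p % 4 = 3 →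
      Subgroup.closure (smallPrimeClasses p (Real.log (4 * p) ^ B)) = ⊤

/-! ### The concrete generator list of CSIDH labels -/

/-- The least `t₀ ∈ {0, …, ℓ - 1}` with `ℓ ∣ t₀² + p` (a square root of `-p` modulo `ℓ`), if any.
[folklore] -/
def sqrtNegMod (ℓ : ℕ) : Option ℕ :=
  (List.range ℓ).find? fun t => decide ((t * t + p) % ℓ = 0)

/-- The generator norm bound `⌊(log 4p)³⌋` (the case `B = 3` of `jmv_smallPrimesGenerate`).
[folklore] -/
def genBound : ℕ := ⌊Real.log (4 * p) ^ (3 : ℝ)⌋₊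

/-- The label (reduced form) of the class of `(ℓ, t + √-p)`. [folklore] -/
def genLabel (ℓ : ℕ) (t : ℤ) : BinQF :=
  ofClass (-(p : ℤ)) (classOf p (primeIdeal p ℓ t))

/-- **The CSIDH generator list**: the labels of the prime ideals `(ℓ, t₀ + √-p)` for the odd
primes `ℓ ≤ ⌊(log 4p)³⌋` modulo which `-p` is a square (or zero), `t₀` the least square root.
CSIDH §3–4 use the `𝔩ᵢ = (ℓᵢ, π - 1)` of the primes `ℓᵢ ∣ p + 1`; the present list is the
GRH-complete one of `jmv_smallPrimesGenerate` with `B = 3`. [folklore] -/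
def gens : List BinQF :=
  ((List.range (genBound p + 1)).filter fun ℓ => decide (ℓ.Prime ∧ ℓ ≠ 2)).filterMap
    fun ℓ => (sqrtNegMod p ℓ).map fun t : ℕ => genLabel p ℓ (t : ℤ)

variable {p}

/-- Members of `gens p` are `genLabel`s of odd primes `ℓ ≤ genBound p` at a root `t₀ < ℓ` of
`t² + p ≡ 0 (mod ℓ)`. [folklore] -/
theorem mem_gens_iff (f : BinQF) :
    f ∈ gens p ↔ ∃ ℓ t : ℕ, ℓ ≤ genBound p ∧ ℓ.Prime ∧ ℓ ≠ 2 ∧ sqrtNegMod p ℓ = some t ∧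
      f = genLabel p ℓ (t : ℤ) := by
  rw [gens, List.mem_filterMap]
  constructor
  · rintro ⟨ℓ, hℓ, hf⟩
    rw [List.mem_filter, List.mem_range, decide_eq_true_eq] at hℓ
    obtain ⟨t, ht, rfl⟩ := Option.map_eq_some_iff.1 hf
    exact ⟨ℓ, t, by omega, hℓ.2.1, hℓ.2.2, ht, rfl⟩
  · rintro ⟨ℓ, t, hℓ, hpr, h2, ht, rfl⟩
    refine ⟨ℓ, ?_, ?_⟩
    · rw [List.mem_filter, List.mem_range, decide_eq_true_eq]
      exact ⟨by omega, hpr, h2⟩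
    · rw [ht]
      rfl

/-- Every member of `gens p` is a label (a reduced primitive positive definite form of
discriminant `-4p`), by Cox Thm. 7.7 (`cox_formClassGroup_holds`). [folklore] -/
theorem isLabel_of_mem_gens {f : BinQF} (hf : f ∈ gens p) :
    IsLabel (-(p : ℤ)) f := by
  obtain ⟨ℓ, t, -, -, -, -, rfl⟩ := (mem_gens_iff f).1 hf
  exact isLabel_ofClass cox_formClassGroup_holds (by have := (Fact.out : p.Prime).one_lt; omega) _

omit [Fact p.Prime] in
/-- `sqrtNegMod` returns a root: `ℓ ∣ t₀² + p` and `t₀ < ℓ`. [folklore] -/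
theorem sqrtNegMod_spec {ℓ t : ℕ} (h : sqrtNegMod p ℓ = some t) : (t * t + p) % ℓ = 0 ∧ t < ℓ := by
  refine ⟨?_, List.mem_range.1 (List.mem_of_find?_eq_some h)⟩
  have := List.find?_some h
  simpa using this

omit [Fact p.Prime] in
/-- If `-p` has a square root modulo `ℓ ≥ 1` then `sqrtNegMod` finds one. [folklore] -/
theorem sqrtNegMod_isSome {ℓ : ℕ} (hℓ : ℓ ≠ 0) {t : ℤ} (ht : (ℓ : ℤ) ∣ t ^ 2 + p) :
    ∃ t₀ : ℕ, sqrtNegMod p ℓ = some t₀ := by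
  suffices h : ((sqrtNegMod p ℓ).isSome : Prop) from Option.isSome_iff_exists.1 h
  rw [sqrtNegMod, List.find?_isSome]
  have hℓ0 : (0 : ℤ) < ℓ := by exact_mod_cast Nat.pos_of_ne_zero hℓ
  have h0 : 0 ≤ t % ℓ := Int.emod_nonneg _ hℓ0.ne'
  have h1 : t % ℓ < ℓ := Int.emod_lt_of_pos _ hℓ0
  refine ⟨(t % ℓ).toNat, List.mem_range.2 (by omega), ?_⟩
  rw [decide_eq_true_eq]
  apply Nat.mod_eq_zero_of_dvd
  rw [← Int.natCast_dvd_natCast]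
  push_cast
  rw [Int.toNat_of_nonneg h0, Int.emod_def]
  have : (t - ℓ * (t / ℓ)) * (t - ℓ * (t / ℓ)) + p =
      (t ^ 2 + p) + ℓ * (ℓ * (t / ℓ) * (t / ℓ) - 2 * t * (t / ℓ)) := by ring
  rw [this]
  exact ht.add (dvd_mul_right _ _)

/-! ### Conjugate prime ideals have inverse classes -/

omit [Fact p.Prime] in
/-- Translating `t` by a multiple of `ℓ` does not change `(ℓ, t + √-p)`. [folklore] -/
theorem primeIdeal_add_mul (ℓ : ℕ) (t k : ℤ) : primeIdeal p ℓ (t + ℓ * k) = primeIdeal p ℓ t := by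
  have : (⟨t + ℓ * k, 1⟩ : ℤ√(-(p : ℤ))) = ⟨t, 1⟩ + (k : ℤ√(-(p : ℤ))) * (ℓ : ℤ√(-(p : ℤ))) := by
    rw [Zsqrtd.ext_iff]
    constructor <;> simp [mul_comm]
  rw [primeIdeal, primeIdeal, this, Ideal.span_pair_add_mul_left]

omit [Fact p.Prime] in
/-- **`(ℓ, t + √-p) · (ℓ, -t + √-p) = (ℓ)`** for `ℓ ∣ t² + p` and `gcd(ℓ, 2t) = 1`: a prime of
norm `ℓ` times its conjugate is the principal ideal `(ℓ)` (Cox, Lemma 7.14: `𝔞 𝔞̄ = N(𝔞) 𝒪`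
for ideals prime to the conductor). [folklore] -/
theorem primeIdeal_mul_primeIdeal_neg {ℓ : ℕ} {t : ℤ} (hdvd : (ℓ : ℤ) ∣ t ^ 2 + p)
    (hco : IsCoprime (ℓ : ℤ) (2 * t)) :
    primeIdeal p ℓ t * primeIdeal p ℓ (-t) = Ideal.span {(ℓ : ℤ√(-(p : ℤ)))} := by
  obtain ⟨m, hm⟩ := hdvd
  obtain ⟨u, v, huv⟩ := hco
  have hprod : (⟨t, 1⟩ : ℤ√(-(p : ℤ))) * ⟨-t, 1⟩ = -(m : ℤ√(-(p : ℤ))) * (ℓ : ℤ√(-(p : ℤ))) := by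
    rw [Zsqrtd.ext_iff]
    constructor
    · simp
      linear_combination -hm
    · simp
  have hx : (⟨t, 1⟩ : ℤ√(-(p : ℤ))) * (ℓ : ℤ√(-(p : ℤ))) - (ℓ : ℤ√(-(p : ℤ))) * ⟨-t, 1⟩ =
      ((2 * t : ℤ) : ℤ√(-(p : ℤ))) * (ℓ : ℤ√(-(p : ℤ))) := by
    rw [Zsqrtd.ext_iff]
    constructor
    · simp
      ring
    · simp
  rw [primeIdeal, primeIdeal, Ideal.span_pair_mul_span_pair]
  apply le_antisymm
  · rw [Ideal.span_le]
    have hgen : (ℓ : ℤ√(-(p : ℤ))) ∈ Ideal.span {(ℓ : ℤ√(-(p : ℤ)))} := Ideal.subset_span rfl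
    rintro y (rfl | rfl | rfl | rfl)
    · exact Ideal.mul_mem_left _ _ hgen
    · exact Ideal.mul_mem_right _ _ hgen
    · exact Ideal.mul_mem_left _ _ hgen
    · rw [SetLike.mem_coe, hprod]
      exact Ideal.mul_mem_left _ _ hgen
  · rw [Ideal.span_le, Set.singleton_subset_iff, SetLike.mem_coe]
    have h1 : ((u * ℓ + v * (2 * t) : ℤ) : ℤ√(-(p : ℤ))) = 1 := by rw [huv]; simp
    have key : (ℓ : ℤ√(-(p : ℤ))) =
        (u : ℤ√(-(p : ℤ))) * ((ℓ : ℤ√(-(p : ℤ))) * (ℓ : ℤ√(-(p : ℤ)))) +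
        (v : ℤ√(-(p : ℤ))) * ((⟨t, 1⟩ : ℤ√(-(p : ℤ))) * (ℓ : ℤ√(-(p : ℤ))) -
          (ℓ : ℤ√(-(p : ℤ))) * ⟨-t, 1⟩) := by
      rw [hx]
      calc (ℓ : ℤ√(-(p : ℤ))) = 1 * ℓ := (one_mul _).symm
        _ = ((u * ℓ + v * (2 * t) : ℤ) : ℤ√(-(p : ℤ))) * ℓ := by rw [h1]
        _ = _ := by push_cast; ring
    have hmem : (u : ℤ√(-(p : ℤ))) * ((ℓ : ℤ√(-(p : ℤ))) * (ℓ : ℤ√(-(p : ℤ)))) +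
        (v : ℤ√(-(p : ℤ))) * ((⟨t, 1⟩ : ℤ√(-(p : ℤ))) * (ℓ : ℤ√(-(p : ℤ))) -
          (ℓ : ℤ√(-(p : ℤ))) * ⟨-t, 1⟩) ∈
        Ideal.span {(ℓ : ℤ√(-(p : ℤ))) * (ℓ : ℤ√(-(p : ℤ))), (ℓ : ℤ√(-(p : ℤ))) * ⟨-t, 1⟩,
          (⟨t, 1⟩ : ℤ√(-(p : ℤ))) * (ℓ : ℤ√(-(p : ℤ))), (⟨t, 1⟩ : ℤ√(-(p : ℤ))) * ⟨-t, 1⟩} :=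
      Ideal.add_mem _ (Ideal.mul_mem_left _ _ (Ideal.subset_span (by simp)))
        (Ideal.mul_mem_left _ _ (Ideal.sub_mem _ (Ideal.subset_span (by simp))
          (Ideal.subset_span (by simp))))
    rw [← key] at hmem
    exact hmem

/-- Hence, for `ℓ ∣ t² + p` with `gcd(ℓ, 2t) = 1`, both ideals are invertible and their classes
are mutually inverse: `classOf (ℓ, -t + √-p) = (classOf (ℓ, t + √-p))⁻¹`. [folklore] -/
theorem classOf_primeIdeal_neg {ℓ : ℕ} (hℓ : ℓ ≠ 0) {t : ℤ} (hdvd : (ℓ : ℤ) ∣ t ^ 2 + p)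
    (hco : IsCoprime (ℓ : ℤ) (2 * t)) :
    classOf p (primeIdeal p ℓ (-t)) = (classOf p (primeIdeal p ℓ t))⁻¹ := by
  set I : FractionalIdeal (ℤ√(-(p : ℤ)))⁰ (FractionRing (ℤ√(-(p : ℤ)))) :=
    (primeIdeal p ℓ t : FractionalIdeal (ℤ√(-(p : ℤ)))⁰ (FractionRing (ℤ√(-(p : ℤ))))) with hI
  set J : FractionalIdeal (ℤ√(-(p : ℤ)))⁰ (FractionRing (ℤ√(-(p : ℤ)))) :=
    (primeIdeal p ℓ (-t) : FractionalIdeal (ℤ√(-(p : ℤ)))⁰ (FractionRing (ℤ√(-(p : ℤ))))) with hJ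
  have hL0 : (ℓ : ℤ√(-(p : ℤ))) ≠ 0 := by
    intro h
    have h' := congrArg Zsqrtd.re h
    rw [Zsqrtd.re_natCast, Zsqrtd.re_zero] at h'
    exact hℓ (by exact_mod_cast h')
  have hℓK : algebraMap (ℤ√(-(p : ℤ))) (FractionRing (ℤ√(-(p : ℤ)))) ℓ ≠ 0 :=
    (map_ne_zero_iff _ (IsFractionRing.injective (ℤ√(-(p : ℤ))) (FractionRing (ℤ√(-(p : ℤ)))))).2
      hL0
  have hIJ : I * J = FractionalIdeal.spanSingleton (ℤ√(-(p : ℤ)))⁰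
      (algebraMap (ℤ√(-(p : ℤ))) (FractionRing (ℤ√(-(p : ℤ)))) ℓ) := by
    rw [hI, hJ, ← FractionalIdeal.coeIdeal_mul, primeIdeal_mul_primeIdeal_neg hdvd hco,
      FractionalIdeal.coeIdeal_span_singleton]
  have hunit : IsUnit (I * J) := by
    rw [hIJ]
    refine IsUnit.of_mul_eq_one (FractionalIdeal.spanSingleton (ℤ√(-(p : ℤ)))⁰
      (algebraMap (ℤ√(-(p : ℤ))) (FractionRing (ℤ√(-(p : ℤ)))) ℓ)⁻¹) ?_
    rw [FractionalIdeal.spanSingleton_mul_spanSingleton, mul_inv_cancel₀ hℓK,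
      FractionalIdeal.spanSingleton_one]
  have hI' : IsUnit I := isUnit_of_mul_isUnit_left hunit
  have hJ' : IsUnit J := isUnit_of_mul_isUnit_right hunit
  rw [classOf_of_isUnit hI', classOf_of_isUnit hJ', eq_inv_iff_mul_eq_one, ← map_mul]
  have hu : hJ'.unit * hI'.unit = hunit.unit :=
    Units.ext (by simp only [Units.val_mul, IsUnit.unit_spec]; exact mul_comm _ _)
  rw [hu, ClassGroup.mk_eq_one_of_coe_ideal (I' := primeIdeal p ℓ t * primeIdeal p ℓ (-t))
    (by rw [IsUnit.unit_spec, hI, hJ, FractionalIdeal.coeIdeal_mul])]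
  exact ⟨ℓ, hL0, primeIdeal_mul_primeIdeal_neg hdvd hco⟩

/-! ### The classes of `gens p` generate `cl(ℤ[√-p])` for large `p` -/

/-- Every JMV generator class of norm bound `(log 4p)³` lies in the subgroup generated by the
classes of `gens p` (conjugates give inverses, translates give the same ideal; Cox Thm. 7.7,
`cox_formClassGroup_holds`: `toClass ∘ ofClass = id`). [folklore] -/
theorem smallPrimeClasses_subset_closure :
    smallPrimeClasses p (Real.log (4 * p) ^ (3 : ℝ)) ⊆
      Subgroup.closure ((toClass (-(p : ℤ))) '' {f | f ∈ gens p}) := by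
  have hp0 : -(p : ℤ) < 0 := by have := (Fact.out : p.Prime).one_lt; omega
  rintro C ⟨ℓ, t, hℓ, hℓ2, hℓx, hdvd, rfl⟩
  obtain ⟨t₀, ht₀⟩ := sqrtNegMod_isSome (p := p) hℓ.ne_zero hdvd
  obtain ⟨hroot, ht₀ℓ⟩ := sqrtNegMod_spec ht₀
  -- the listed generator and its class
  have hmem : genLabel p ℓ (t₀ : ℤ) ∈ gens p :=
    (mem_gens_iff _).2 ⟨ℓ, t₀, Nat.le_floor hℓx, hℓ, hℓ2, ht₀, rfl⟩
  have hC₀ : classOf p (primeIdeal p ℓ t₀) ∈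
      Subgroup.closure ((toClass (-(p : ℤ))) '' {f | f ∈ gens p}) := by
    refine Subgroup.subset_closure ⟨genLabel p ℓ t₀, hmem, ?_⟩
    rw [genLabel, toClass_ofClass cox_formClassGroup_holds hp0]
  -- `ℓ ∣ (t - t₀)(t + t₀)`
  have hdvd₀ : (ℓ : ℤ) ∣ (t₀ : ℤ) ^ 2 + p := by
    have : ((t₀ * t₀ + p : ℕ) : ℤ) % ℓ = 0 := by exact_mod_cast hroot
    have := Int.dvd_of_emod_eq_zero this
    push_cast at this
    simpa [sq] using this
  have hdiff : (ℓ : ℤ) ∣ (t - t₀) * (t + t₀) := by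
    have h := hdvd.sub hdvd₀
    have e : t ^ 2 + p - ((t₀ : ℤ) ^ 2 + p) = (t - t₀) * (t + t₀) := by ring
    rwa [e] at h
  have hprime : Prime (ℓ : ℤ) := Nat.prime_iff_prime_int.1 hℓ
  rcases hprime.dvd_or_dvd hdiff with ⟨k, hk⟩ | ⟨k, hk⟩
  · -- `t = t₀ + ℓ k`: same ideal
    have ht : t = t₀ + ℓ * k := by linarith
    rw [ht, primeIdeal_add_mul]
    exact hC₀
  · -- `t = -t₀ + ℓ k`: conjugate ideal
    have ht : t = -(t₀ : ℤ) + ℓ * k := by linarith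
    rw [ht, primeIdeal_add_mul]
    by_cases h0 : (ℓ : ℤ) ∣ t₀
    · -- then `-t₀ ≡ t₀`, same ideal again
      obtain ⟨j, hj⟩ := h0
      have : -(t₀ : ℤ) = t₀ + ℓ * (-2 * j) := by linarith
      rw [this, primeIdeal_add_mul]
      exact hC₀
    · have hco : IsCoprime (ℓ : ℤ) (2 * t₀) := by
        have h2 : ¬ (ℓ : ℤ) ∣ 2 := by
          intro h
          have : ℓ ∣ 2 := by exact_mod_cast h
          exact hℓ2 ((Nat.prime_dvd_prime_iff_eq hℓ Nat.prime_two).1 this)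
        have hnd : ¬ (ℓ : ℤ) ∣ 2 * t₀ := fun h => (hprime.dvd_or_dvd h).elim h2 h0
        exact (Irreducible.coprime_iff_not_dvd hprime.irreducible).2 hnd
      rw [classOf_primeIdeal_neg hℓ.ne_zero hdvd₀ hco]
      exact Subgroup.inv_mem _ hC₀

/-- **Under GRH the CSIDH generator list generates the class group**: assuming
`jmv_smallPrimesGenerate` (JMV Cor. 1.3) and ERH (Cox Thm. 7.7 being the tree's
`cox_formClassGroup_holds`), there is `P₀` such that for every prime `p ≥ P₀`, `p ≡ 3 (mod 4)`,
the classes of `gens p` generate `cl(ℤ[√-p]) = ClassGroup (ℤ√(-p))`. [folklore] -/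
theorem exists_closure_toClass_gens_eq_top (hjmv : jmv_smallPrimesGenerate)
    (hERH : Literature.NumberTheory.LFunctions.ExtendedRiemannHypothesis) :
    ∃ P₀ : ℕ, ∀ (p : ℕ) [Fact p.Prime], P₀ ≤ p → p % 4 = 3 →
      Subgroup.closure ((toClass (-(p : ℤ))) '' {f | f ∈ gens p}) = ⊤ := by
  obtain ⟨P₀, hP₀⟩ := hjmv hERH 3 (by norm_num)
  refine ⟨P₀, fun p _ hp hp4 => ?_⟩
  rw [eq_top_iff, ← hP₀ p hp hp4]
  exact (Subgroup.closure_le _).2 smallPrimeClasses_subset_closure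

end Literature.Computability.Cryptography.Csidh
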